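import Mathlib
import HarnessLib
import Summits.HubbardSuperconductivity.HubbardSuperconductivity.Theorems.KLProgrammeKLRegimeEngineIsoTupleV17FDoor

/-!
# Route `KLProgramme` — ENGINE item stmt-HubbardSuperconductivity-20437 `KLRegimeEngineV17F2`, stub (c) value lane: the `hshift` binder's CONSUMER HALF —
# from a frame-LIPSCHITZ response of the pair amplitude to `≤ frameShiftBar` (cell gate-hubbard-kl, seat hubbard-kl-k3c2-p2 g21; located «(c)-HSHIFT-4LEG»)

The (c)-OUT chain (`outClass_hout_klEngGeo13/14*`, `klvrF_outClass_of_sameFrame_frameShift`, `stepValuesV17F2_of_residue_sameFrame_*`) carries the binder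
`hshift : ‖𝒞ₙ[Kₙ](Qm,x,y) − 𝒞ₙ[Kₙ₋₁](Qm,x,y)‖ ≤ frameShiftBar P Q U n` — the response of the scale-`n` pair amplitude to the frame shift `Kₙ₋₁ → Kₙ`.  No producer exists in the tree
(p2's S6 door (1) …EngineFrameShiftResponse has the symbol layer and the TWO-leg/self-energy responses only).  This file fixes the INTERFACE the four-leg door must meet and
discharges everything downstream of it:
* `zpow_jets_zero` — the (I-F jets) `j = 0` rate `4^{(0−2)n} = (4ⁿ)⁻¹(4ⁿ)⁻¹`;
* **`hshift_of_frameResponse`** — if `‖a − b‖ ≤ ℓ·frameDist K₁ K₀` with a response constant `ℓ ≤ cℓ·(KlamU)²/Λₙ₊₁` (the second-order currency: the bare `U` is frame-blind),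
  the jets give `frameDist K₁ K₀ ≤ Gfr₀·|U|·4^{−2n}`, and the U-door `512·cℓ·Gfr₀·|U| ≤ Q.CR` holds, then `‖a − b‖ ≤ frameShiftBar P Q U (n+1)` (`= Q.CR(KlamU)²4^{−(n+1)}`;
  …SplitSlotsV17F l.124's own sizing remark, now a lemma);
* **`hshift_of_frameResponse_hist`** — history-keyed at the (c) closer's index: under `HistP klPredsV17F2 … 0 n` (jets of the pieces `m < n` from the renorm slot),
  `1 ≤ n`, a response `‖𝒞ₙ[Kₙ] − 𝒞ₙ[Kₙ₋₁]‖ ≤ ℓ·frameDist Kₙ Kₙ₋₁` with `ℓ ≤ cℓ(KlamU)²/Λₙ` and `512·cℓ·Gfr₀|U| ≤ Q.CR` ⇒ `hshift` at `n`.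
WHAT THE DOOR MUST DELIVER (p2 / owner named by the pen): `∀ Qm x y (ball), ‖klPairAmplitude … K₁ n Qm x y − klPairAmplitude … K₀ n Qm x y‖ ≤ cℓ·(KlamU)²/Λₙ · frameDist K₁ K₀` for admissible
frames `K₀, K₁` (both `FrameOK`), with an explicit `cℓ` (it fixes the U-door `512cℓ·Gfr₀·U ≤ Q.CR`, a `klEngU₀` entry).  Arithmetic only; nothing about the model is asserted;
nothing asserts (c), K3 or superconductivity.  0 kit · 0 lit.
-/

noncomputable section

namespace Summit.HubbardSuperconductivity.HubbardSuperconductivity.Theorems.KLRegimeSplit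

set_option linter.dupNamespace false -- summit = problem name (single-conjunct summit), D-0017

open Real Finset Literature.MathematicalPhysics.QuantumLattice Literature.Probability.LatticeModels
open Summit.HubbardSuperconductivity.HubbardSuperconductivity.Theorems.KLProgrammeLegKernels
open Summit.HubbardSuperconductivity.HubbardSuperconductivity.Theorems.EngineV8

/-- The (I-F jets) `j = 0` rate: `4^{(0−2)·n} = (4ⁿ)⁻¹·(4ⁿ)⁻¹`. -/
theorem zpow_jets_zero (n : ℕ) : (4 : ℝ) ^ ((((0 : ℕ) : ℤ) - 2) * (n : ℤ)) = ((4 : ℝ) ^ n)⁻¹ * ((4 : ℝ) ^ n)⁻¹ := by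
  have e : (((0 : ℕ) : ℤ) - 2) * (n : ℤ) = -((2 * n : ℕ) : ℤ) := by push_cast; ring
  rw [e, zpow_neg, zpow_natCast, ← mul_inv, ← pow_add, show n + n = 2 * n by ring]

/-- `1/Λₙ₊₁ = 32·4ⁿ⁺¹` (`Λₙ₊₁ = klE0·(4ⁿ⁺¹)⁻¹`, `klE0 = 1/32`). -/
theorem inv_klScale_succ_eq (n : ℕ) : (klScale klE0 (n + 1))⁻¹ = 32 * (4 : ℝ) ^ (n + 1) := by
  show (klE0 * ((4 : ℝ) ^ (n + 1))⁻¹)⁻¹ = 32 * (4 : ℝ) ^ (n + 1)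
  unfold klE0; rw [mul_inv, inv_inv]; norm_num

/-- **`hshift` FROM A FRAME-LIPSCHITZ RESPONSE** (module docstring): `‖a − b‖ ≤ ℓ·frameDist K₁ K₀`, `0 ≤ ℓ ≤ cℓ·(KlamU)²/Λₙ₊₁`, `frameDist K₁ K₀ ≤ Gfr₀·uPow 0 U·4^{(0−2)n}`,
`0 ≤ Gfr₀`, `0 ≤ cℓ`, `512·cℓ·Gfr₀·|U| ≤ Q.CR` ⇒ `‖a − b‖ ≤ frameShiftBar P Q U (n+1)`. -/
theorem hshift_of_frameResponse {P : SplitConsts} {Q : EngConsts} {R : RenConsts} {U : ℝ} {a b : ℂ} {ℓ cℓ : ℝ} {K₁ K₀ : TrigPolyC4v} (n : ℕ)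
    (hresp : ‖a - b‖ ≤ ℓ * frameDist K₁ K₀) (hℓ : ℓ ≤ cℓ * (P.Klam * U) ^ 2 / klScale klE0 (n + 1))
    (hdist : frameDist K₁ K₀ ≤ R.Gfr 0 * uPow 0 U * (4 : ℝ) ^ ((((0 : ℕ) : ℤ) - 2) * (n : ℤ))) (hG0 : 0 ≤ R.Gfr 0) (hcℓ : 0 ≤ cℓ)
    (hdoor : 512 * cℓ * R.Gfr 0 * |U| ≤ Q.CR) :
    ‖a - b‖ ≤ frameShiftBar P Q U (n + 1) := by
  have hfd : 0 ≤ frameDist K₁ K₀ := frameDist_nonneg K₁ K₀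
  have hK : 0 ≤ (P.Klam * U) ^ 2 := sq_nonneg _
  have hΛ := klth_klScale_pos (n + 1)
  have h4n : 0 < ((4 : ℝ) ^ n)⁻¹ := by positivity
  rw [zpow_jets_zero] at hdist
  have hu : uPow 0 U = |U| := by simp [uPow]
  rw [hu] at hdist
  -- `‖a − b‖ ≤ (cℓ K²/Λₙ₊₁)·Gfr₀|U|·4^{−2n}`
  have h1 : ‖a - b‖ ≤ cℓ * (P.Klam * U) ^ 2 / klScale klE0 (n + 1) * (R.Gfr 0 * |U| * (((4 : ℝ) ^ n)⁻¹ * ((4 : ℝ) ^ n)⁻¹)) := by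
    have hd0 : 0 ≤ R.Gfr 0 * |U| * (((4 : ℝ) ^ n)⁻¹ * ((4 : ℝ) ^ n)⁻¹) := by positivity
    have hℓ0 : 0 ≤ cℓ * (P.Klam * U) ^ 2 / klScale klE0 (n + 1) := by positivity
    calc ‖a - b‖ ≤ ℓ * frameDist K₁ K₀ := hresp
      _ ≤ (cℓ * (P.Klam * U) ^ 2 / klScale klE0 (n + 1)) * frameDist K₁ K₀ := mul_le_mul_of_nonneg_right hℓ hfd
      _ ≤ (cℓ * (P.Klam * U) ^ 2 / klScale klE0 (n + 1)) * (R.Gfr 0 * |U| * (((4 : ℝ) ^ n)⁻¹ * ((4 : ℝ) ^ n)⁻¹)) :=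
          mul_le_mul_of_nonneg_left hdist hℓ0
  -- rewrite `1/Λₙ₊₁ = 8·4ⁿ⁺¹` and compare with `frameShiftBar = Q.CR·K²·(4⁻¹)ⁿ⁺¹`
  unfold frameShiftBar
  rw [div_eq_mul_inv, inv_klScale_succ_eq] at h1
  have e : cℓ * (P.Klam * U) ^ 2 * (32 * (4 : ℝ) ^ (n + 1)) * (R.Gfr 0 * |U| * (((4 : ℝ) ^ n)⁻¹ * ((4 : ℝ) ^ n)⁻¹)) =
      (512 * cℓ * R.Gfr 0 * |U|) * (P.Klam * U) ^ 2 * ((4 : ℝ)⁻¹) ^ (n + 1) := by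
    rw [inv_pow, pow_succ, pow_succ]
    field_simp
    ring
  rw [e] at h1
  have h2 : (512 * cℓ * R.Gfr 0 * |U|) * (P.Klam * U) ^ 2 * ((4 : ℝ)⁻¹) ^ (n + 1) ≤ Q.CR * (P.Klam * U) ^ 2 * ((4 : ℝ)⁻¹) ^ (n + 1) := by
    have hq : 0 ≤ (P.Klam * U) ^ 2 * ((4 : ℝ)⁻¹) ^ (n + 1) := by positivity
    have := mul_le_mul_of_nonneg_right hdoor hq
    calc (512 * cℓ * R.Gfr 0 * |U|) * (P.Klam * U) ^ 2 * ((4 : ℝ)⁻¹) ^ (n + 1) = (512 * cℓ * R.Gfr 0 * |U|) * ((P.Klam * U) ^ 2 * ((4 : ℝ)⁻¹) ^ (n + 1)) := by ring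
      _ ≤ Q.CR * ((P.Klam * U) ^ 2 * ((4 : ℝ)⁻¹) ^ (n + 1)) := this
      _ = Q.CR * (P.Klam * U) ^ 2 * ((4 : ℝ)⁻¹) ^ (n + 1) := by ring
  exact h1.trans h2

section Model

variable {L M : ℕ} [NeZero L] [NeZero M] {G : GeoConsts} {P : SplitConsts} {Q : EngConsts} {R : RenConsts} {β U μ : ℝ} {n : ℕ}

/-- **`hshift` AT THE (c) CLOSER'S INDEX FROM A FRAME-LIPSCHITZ RESPONSE, history-keyed**: `HistP klPredsV17F2 … 0 n` (the renorm slot's (I-F jets) at every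
`m < n`), `1 ≤ n`, `0 ≤ Gfr₀`, a response `‖𝒞ₙ[Kₙ](Qm,x,y) − 𝒞ₙ[Kₙ₋₁](Qm,x,y)‖ ≤ ℓ·frameDist Kₙ Kₙ₋₁` with `ℓ ≤ cℓ(KlamU)²/Λₙ`, and the U-door `512·cℓ·Gfr₀·|U| ≤ Q.CR`
⇒ `‖𝒞ₙ[Kₙ] − 𝒞ₙ[Kₙ₋₁]‖ ≤ frameShiftBar P Q U n`. -/
theorem hshift_of_frameResponse_hist (hhist : HistP klPredsV17F2 L M G P Q R β U μ 0 n) (hn1 : 1 ≤ n) (hG0 : 0 ≤ R.Gfr 0) {ℓ cℓ : ℝ} (hcℓ : 0 ≤ cℓ)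
    {Qm x y : TorusSite 2 L}
    (hresp : ‖klPairAmplitude L M β U μ (klFlowFrameU L M β U μ n) n Qm x y - klPairAmplitude L M β U μ (klFlowFrameU L M β U μ (n - 1)) n Qm x y‖ ≤
      ℓ * frameDist (klFlowFrameU L M β U μ n) (klFlowFrameU L M β U μ (n - 1)))
    (hℓ : ℓ ≤ cℓ * (P.Klam * U) ^ 2 / klScale klE0 n) (hdoor : 512 * cℓ * R.Gfr 0 * |U| ≤ Q.CR) :
    ‖klPairAmplitude L M β U μ (klFlowFrameU L M β U μ n) n Qm x y - klPairAmplitude L M β U μ (klFlowFrameU L M β U μ (n - 1)) n Qm x y‖ ≤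
      frameShiftBar P Q U n := by
  obtain ⟨m, rfl⟩ : ∃ m, n = m + 1 := ⟨n - 1, by omega⟩
  have hh := (histP_klPredsV17F2_iff L M G P Q R β U μ 0 (m + 1)).1 hhist
  have hJ : ∀ k < m + 1, FlowPieceJetsAt L M β U μ R k := fun k hk => ((hh k hk).2.1).2.1
  have hdist := frameDist_klFlowFrameU_succ_le (L := L) (M := M) (β := β) (U := U) (μ := μ) (R := R) (j := m) hJ
  rw [show m + 1 - 1 = m by omega] at hresp ⊢
  exact hshift_of_frameResponse (P := P) (Q := Q) m hresp hℓ hdist hG0 hcℓ hdoor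

end Model

end Summit.HubbardSuperconductivity.HubbardSuperconductivity.Theorems.KLRegimeSplit

end
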